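import Mathlib
import Summits.ResolutionOfSingularities.ResolutionOfSingularities.Theorems.FrobeniusClosingSteerCotangentDerivationTwo
import Summits.ResolutionOfSingularities.ResolutionOfSingularities.Theorems.FrobeniusClosingSteerLowOrderDetector
import Summits.ResolutionOfSingularities.ResolutionOfSingularities.Theorems.FrobeniusClosingSteerLowOrderChart

/-!
# Crux `Steer` (stmt-ResolutionOfSingularities-16345), σ-residual LOW half at `p = 2`:
# `lowOrder_step_two`, FIRST-ORDER engine (the kernel vector of the polar matrix)

OURS (campaign `res-hironaka`, rung L ★L-G4, slot W4.1, chain W4.1; seat `res-D-pv-028` g6, res-L0-w41-plan-1 RULING 15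
(15b); replaces the role of no printed item; NOT a statement of the manuscript under review [claim: Hironaka2017,
status: under-review]; AI review is weaker than expert review).

ABSTRACT SETTING (characteristic `2`, no valuation): local subrings `R ≤ R₁` of a field `K` with `𝔪_R ⊆ 𝔫 := 𝔪_{R₁}`
(`hloc`), residues of `R` squares (`hperf`), `dim_κ₁ 𝔫/𝔫² = 4`; generators `u : Fin h → R`, `w : Fin e → R` of `𝔪_R`
(`h + e = 4`; `P = (u)` is the centre), the exceptional parameter `x' ∈ 𝔫` (`x' = Σ c_j u_j`) and the quotients
`v_j ∈ R₁` with `u_j = x' · v_j`; an additive map `δ : R₁ → 𝔫/𝔫²` with Leibniz rule, killing squares, equal to the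
projection on `𝔫` (stub-3's cotangent derivation), whose values on `R` and on the `v_j` span `𝔫/𝔫²` (layer 2
`LowOrderChart.span_delta_eq_top`). The transformed radicand is `f₁ = Σ_{j,k} G_{jk} v_j v_k + θ + G'²` with
`G_{jk} ∈ R` (the coefficient matrix of `F = f − g_σ² = Σ G_{jk} u_j u_k ∈ P²`) and `θ ∈ J := (x', w) R₁`.

* §1 bookkeeping: `Σ c_j v_j = 1` (`sum_inclusion_c_mul_v`), the relation `Σ c̄_j δ v_j ∈ M''`
  (`M'' := span (δ x', δ w_l)`), `finrank M'' = e + 1` and the independence of `(δ x', δ w_l)` (`finrank_old_span`);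
* §2 `kernel_of_high` — **FIRST ORDER**: if SOME cleaning `f₁ − g'²` lies in `𝔫²` then the residue vector `v̄` is a
  KERNEL VECTOR of the polar matrix `B̄ = Ḡ + Ḡᵀ`: `δ(f₁ − g'²) = 0` gives `Σ_k (B̄ v̄)_k δ v_k ∈ M''`; with the relation
  `Σ c̄_j δ v_j ∈ M''` (five vectors spanning a 4-space) the two are proportional (layer 1
  `smul_of_two_relations_mod_span`), and the alternating self-pairing `v̄ᵀ B̄ v̄ = 0`
  (stub-3 `CotangentDerivation.sum_polar_self_eq_zero`) against `c̄ · v̄ = 1` kills the factor.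
[folklore]
-/

-- The namespace mirrors the chain's helper layout (`…Theorems.SwitchingDichotomy.<Piece>`) on purpose.
set_option linter.dupNamespace false

noncomputable section

namespace Summit.ResolutionOfSingularities.ResolutionOfSingularities.Theorems.SwitchingDichotomy.LowOrderFirst

open IsLocalRing Module Literature.AlgebraicGeometry.Resolution
open Summit.ResolutionOfSingularities.ResolutionOfSingularities.Theorems.SwitchingDichotomy

universe u

variable {K : Type u} [Field K] [CharP K 2]
variable {R R₁ : Subring K} [IsLocalRing R] [IsLocalRing R₁] (hRR₁ : R ≤ R₁)
  (hloc : ∀ m : R, m ∈ maximalIdeal R → residue R₁ (Subring.inclusion hRR₁ m) = 0)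
  (hperf : ∀ a : R, ∃ b : R, a - b ^ 2 ∈ maximalIdeal R)
  {h e : ℕ} (u : Fin h → R) (w : Fin e → R)
  (huw : Ideal.span (Set.range u ∪ Set.range w) = maximalIdeal R)
  (x' : R₁) (hx'm : x' ∈ maximalIdeal R₁) (hx'0 : x' ≠ 0)
  (v : Fin h → R₁) (hv : ∀ j, Subring.inclusion hRR₁ (u j) = x' * v j)
  (c : Fin h → R) (hc : Subring.inclusion hRR₁ (∑ j, c j * u j) = x')
  (δ : R₁ → CotangentSpace R₁)
  (hδadd : ∀ a b : R₁, δ (a + b) = δ a + δ b)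
  (hδmul : ∀ a b : R₁, δ (a * b) = residue R₁ a • δ b + residue R₁ b • δ a)
  (hδmem : ∀ (m : R₁) (hm : m ∈ maximalIdeal R₁), δ m = (maximalIdeal R₁).toCotangent ⟨m, hm⟩)
  (hδsq : ∀ b : R₁, δ (b ^ 2) = 0)

/-! ## §1 Bookkeeping -/

section Bookkeeping

omit [CharP K 2] [IsLocalRing R] [IsLocalRing R₁] in
include hv hc hx'0 in
/-- `Σ_j c_j · v_j = 1` in `R₁` (divide `x' = Σ c_j u_j = x' · Σ c_j v_j` by `x' ≠ 0`). [folklore] -/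
theorem sum_inclusion_c_mul_v : ∑ j, Subring.inclusion hRR₁ (c j) * v j = 1 := by
  have h1 : x' * ∑ j, Subring.inclusion hRR₁ (c j) * v j = x' * 1 := by
    rw [mul_one, Finset.mul_sum]
    conv_rhs => rw [← hc, map_sum]
    refine Finset.sum_congr rfl fun j _ => ?_
    rw [map_mul, hv j]; ring
  exact mul_left_cancel₀ hx'0 h1

omit [CharP K 2] [IsLocalRing R] in
include hv hc hx'0 in
/-- `Σ_j c̄_j · v̄_j = 1` in the residue field of `R₁`. [folklore] -/
theorem sum_residue_c_mul_v :
    ∑ j, residue R₁ (Subring.inclusion hRR₁ (c j)) * residue R₁ (v j) = 1 := by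
  have := congrArg (residue R₁) (sum_inclusion_c_mul_v hRR₁ u x' hx'0 v hv c hc)
  simpa [map_sum, map_mul] using this

omit [CharP K 2] [IsLocalRing R] in
include hv hc hx'0 in
/-- The residue vector `c̄` is non-zero. [folklore] -/
theorem residue_c_ne_zero : (fun j => residue R₁ (Subring.inclusion hRR₁ (c j))) ≠ 0 := by
  intro h0
  have h1 := sum_residue_c_mul_v hRR₁ u x' hx'0 v hv c hc
  rw [Finset.sum_eq_zero fun j _ => by rw [show residue R₁ (Subring.inclusion hRR₁ (c j)) = 0 from
    congrFun h0 j, zero_mul]] at h1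
  exact zero_ne_one h1

omit [CharP K 2] in
include hδadd in
/-- `δ` is additive on finite sums. [folklore] -/
theorem delta_sum {ι : Type*} (s : Finset ι) (f : ι → R₁) : δ (∑ i ∈ s, f i) = ∑ i ∈ s, δ (f i) :=
  map_sum (AddMonoidHom.mk' δ hδadd) _ _

omit [CharP K 2] in
include hδadd in
/-- `δ (a - b) = δ a - δ b`. [folklore] -/
theorem delta_sub (a b : R₁) : δ (a - b) = δ a - δ b := by
  rw [eq_sub_iff_add_eq, ← hδadd, sub_add_cancel]

omit [CharP K 2] in
include hloc hperf huw hx'm hv hδadd hδmul hδsq in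
/-- `δ` of an old element lies in `M'' = span (δ x', δ w_l)` (layer 2 `LowOrderChart.delta_old_mem_span`, with the
family written through `Fin.cons`). [folklore] -/
theorem delta_inclusion_mem (a : R) :
    δ (Subring.inclusion hRR₁ a) ∈ Submodule.span (ResidueField R₁)
      (Set.range (Fin.cons (δ x') (fun l => δ (Subring.inclusion hRR₁ (w l))) : Fin (e + 1) → CotangentSpace R₁)) := by
  rw [Fin.range_cons]
  have hx'res : residue R₁ x' = 0 := (residue_eq_zero_iff _).mpr hx'm
  exact LowOrderChart.delta_old_mem_span hRR₁ hperf u w huw (fun m hm => hloc m hm) x' hx'res v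
    (fun j => hv j) δ hδadd hδmul hδsq a

omit [CharP K 2] in
include hloc hperf huw hx'm hv hc hx'0 hδadd hδmul hδsq in
/-- **The relation**: `Σ_j c̄_j • δ v_j ∈ M''` (from `δ (Σ c_j v_j) = δ 1 = 0` and Leibniz). [folklore] -/
theorem relation_mem :
    ∑ j, residue R₁ (Subring.inclusion hRR₁ (c j)) • δ (v j) ∈ Submodule.span (ResidueField R₁)
      (Set.range (Fin.cons (δ x') (fun l => δ (Subring.inclusion hRR₁ (w l))) : Fin (e + 1) → CotangentSpace R₁)) := by
  set M := Submodule.span (ResidueField R₁)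
      (Set.range (Fin.cons (δ x') (fun l => δ (Subring.inclusion hRR₁ (w l))) : Fin (e + 1) → CotangentSpace R₁))
  have h1 := sum_inclusion_c_mul_v hRR₁ u x' hx'0 v hv c hc
  have h0 : δ (∑ j, Subring.inclusion hRR₁ (c j) * v j) = 0 := by rw [h1]; simpa using hδsq 1
  rw [delta_sum δ hδadd] at h0
  simp only [hδmul] at h0
  rw [Finset.sum_add_distrib] at h0
  have : ∑ j, residue R₁ (Subring.inclusion hRR₁ (c j)) • δ (v j) =
      -∑ j, residue R₁ (v j) • δ (Subring.inclusion hRR₁ (c j)) := eq_neg_of_add_eq_zero_left h0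
  rw [this]
  refine M.neg_mem (M.sum_mem fun j _ => M.smul_mem _ ?_)
  exact delta_inclusion_mem hRR₁ hloc hperf u w huw x' hx'm v hv δ hδadd hδmul hδsq (c j)

end Bookkeeping

/-! ## §2 Dimensions: `finrank M'' = e + 1`, the old classes are independent -/

section Dimension

variable [IsNoetherianRing R₁] (hdim₁ : finrank (ResidueField R₁) (CotangentSpace R₁) = 4) (hhe : h + e = 4)
  (hspan : Submodule.span (ResidueField R₁)
    (Set.range (fun a : R => δ ⟨a, hRR₁ a.2⟩) ∪ Set.range (fun j => δ (v j))) = ⊤)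

omit [CharP K 2] [IsNoetherianRing R₁] in
include hloc hperf huw hx'm hv hδadd hδmul hδsq hspan in
/-- `span (δ v_j) ⊔ M'' = ⊤`. [folklore] -/
theorem span_v_sup_old_eq_top :
    Submodule.span (ResidueField R₁) (Set.range fun j => δ (v j)) ⊔ Submodule.span (ResidueField R₁)
      (Set.range (Fin.cons (δ x') (fun l => δ (Subring.inclusion hRR₁ (w l))) : Fin (e + 1) → CotangentSpace R₁)) = ⊤ := by
  rw [eq_top_iff, ← hspan, Submodule.span_le]
  rintro z (⟨a, rfl⟩ | ⟨j, rfl⟩)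
  · exact Submodule.mem_sup_right
      (delta_inclusion_mem hRR₁ hloc hperf u w huw x' hx'm v hv δ hδadd hδmul hδsq a)
  · exact Submodule.mem_sup_left (Submodule.subset_span ⟨j, rfl⟩)

omit [CharP K 2] in
include hloc hperf huw hx'm hv hc hx'0 hδadd hδmul hδsq hdim₁ hhe hspan in
/-- **`finrank M'' = e + 1`**: `≤` since `M''` is spanned by `e + 1` vectors; `≥` because `κ₁^h → V ⧸ M''`,
`e ↦ Σ e_j δ v_j`, is onto with the non-zero vector `c̄` in its kernel, so `4 − finrank M'' ≤ h − 1`. [folklore] -/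
theorem finrank_old_span :
    finrank (ResidueField R₁) (Submodule.span (ResidueField R₁)
      (Set.range (Fin.cons (δ x') (fun l => δ (Subring.inclusion hRR₁ (w l))) : Fin (e + 1) → CotangentSpace R₁))) =
      e + 1 := by
  classical
  set M := Submodule.span (ResidueField R₁)
      (Set.range (Fin.cons (δ x') (fun l => δ (Subring.inclusion hRR₁ (w l))) : Fin (e + 1) → CotangentSpace R₁))
    with hM
  apply le_antisymm
  · have := finrank_range_le_card (R := ResidueField R₁)
      (Fin.cons (δ x') (fun l => δ (Subring.inclusion hRR₁ (w l))) : Fin (e + 1) → CotangentSpace R₁)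
    simpa [Set.finrank] using this
  · -- the map `κ₁^h → V ⧸ M`
    let L : (Fin h → ResidueField R₁) →ₗ[ResidueField R₁] (CotangentSpace R₁ ⧸ M) :=
      M.mkQ.comp (Fintype.linearCombination (ResidueField R₁) fun j => δ (v j))
    have hL : ∀ g : Fin h → ResidueField R₁, L g = M.mkQ (∑ j, g j • δ (v j)) := by
      intro g; simp [L, Fintype.linearCombination_apply]
    have hrange : LinearMap.range L = ⊤ := by
      rw [LinearMap.range_comp, Fintype.range_linearCombination, Submodule.map_mkQ_eq_top, sup_comm]
      exact span_v_sup_old_eq_top hRR₁ hloc hperf u w huw x' hx'm v hv δ hδadd hδmul hδsq hspan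
    have hcker : (fun j => residue R₁ (Subring.inclusion hRR₁ (c j))) ∈ LinearMap.ker L := by
      rw [LinearMap.mem_ker, hL, Submodule.mkQ_apply, Submodule.Quotient.mk_eq_zero]
      exact relation_mem hRR₁ hloc hperf u w huw x' hx'm hx'0 v hv c hc δ hδadd hδmul hδsq
    have hker1 : 1 ≤ finrank (ResidueField R₁) (LinearMap.ker L) := by
      rw [Nat.one_le_iff_ne_zero, Ne, Submodule.finrank_eq_zero]
      intro hbot
      have := residue_c_ne_zero hRR₁ u x' hx'0 v hv c hc
      rw [hbot] at hcker
      exact this ((Submodule.mem_bot _).mp hcker)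
    have h1 := LinearMap.finrank_range_add_finrank_ker L
    rw [hrange, finrank_top, Module.finrank_fintype_fun_eq_card, Fintype.card_fin] at h1
    have h2 := Submodule.finrank_quotient_add_finrank M
    rw [hdim₁] at h2
    omega

omit [CharP K 2] in
include hloc hperf huw hx'm hv hc hx'0 hδadd hδmul hδsq hdim₁ hhe hspan in
/-- The old classes `δ x', δ w_l` are linearly independent. [folklore] -/
theorem linearIndependent_old :
    LinearIndependent (ResidueField R₁)
      (Fin.cons (δ x') (fun l => δ (Subring.inclusion hRR₁ (w l))) : Fin (e + 1) → CotangentSpace R₁) := by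
  rw [linearIndependent_iff_card_eq_finrank_span, Fintype.card_fin, Set.finrank]
  exact (finrank_old_span hRR₁ hloc hperf u w huw x' hx'm hx'0 v hv c hc δ hδadd hδmul hδsq hdim₁ hhe hspan).symm

omit [CharP K 2] in
include hloc hperf huw hx'm hv hc hx'0 hδadd hδmul hδsq hdim₁ hhe hspan in
/-- **Relations among the `δ v_j` modulo `M''` are multiples of `c̄`** (layer 1 `smul_of_two_relations_mod_span`).
[folklore] -/
theorem smul_of_relation (g : Fin h → ResidueField R₁)
    (hg : ∑ j, g j • δ (v j) ∈ Submodule.span (ResidueField R₁)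
      (Set.range (Fin.cons (δ x') (fun l => δ (Subring.inclusion hRR₁ (w l))) : Fin (e + 1) → CotangentSpace R₁))) :
    ∃ t : ResidueField R₁, ∀ j, g j = t * residue R₁ (Subring.inclusion hRR₁ (c j)) :=
  LowOrderDetector.smul_of_two_relations_mod_span (fun j => δ (v j)) _
    (span_v_sup_old_eq_top hRR₁ hloc hperf u w huw x' hx'm v hv δ hδadd hδmul hδsq hspan)
    (by rw [finrank_old_span hRR₁ hloc hperf u w huw x' hx'm hx'0 v hv c hc δ hδadd hδmul hδsq hdim₁ hhe hspan, hdim₁]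
        omega)
    _ (residue_c_ne_zero hRR₁ u x' hx'0 v hv c hc)
    (relation_mem hRR₁ hloc hperf u w huw x' hx'm hx'0 v hv c hc δ hδadd hδmul hδsq) g hg

end Dimension

/-! ## §3 FIRST ORDER: the residue vector `v̄` is a kernel vector of the polar matrix -/

section FirstOrder

variable [IsNoetherianRing R₁] (hdim₁ : finrank (ResidueField R₁) (CotangentSpace R₁) = 4) (hhe : h + e = 4)
  (hspan : Submodule.span (ResidueField R₁)
    (Set.range (fun a : R => δ ⟨a, hRR₁ a.2⟩) ∪ Set.range (fun j => δ (v j))) = ⊤)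
  (G : Fin h → Fin h → R) (θ G' f₁ : R₁)
  (hθ : θ ∈ Ideal.span (Set.range (Fin.cons x' (fun l => Subring.inclusion hRR₁ (w l)) : Fin (e + 1) → R₁)))
  (hf₁ : f₁ = ∑ j, ∑ k, Subring.inclusion hRR₁ (G j k) * v j * v k + θ + G' ^ 2)

omit [CharP K 2] [IsNoetherianRing R₁] in
include hloc huw hx'm hδadd hδmul hθ in
/-- `δ θ ∈ M''` for `θ ∈ J = (x', w_l)`: the generators of `J` have residue `0`. [folklore] -/
theorem delta_theta_mem :
    δ θ ∈ Submodule.span (ResidueField R₁)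
      (Set.range (Fin.cons (δ x') (fun l => δ (Subring.inclusion hRR₁ (w l))) : Fin (e + 1) → CotangentSpace R₁)) := by
  classical
  set M := Submodule.span (ResidueField R₁)
      (Set.range (Fin.cons (δ x') (fun l => δ (Subring.inclusion hRR₁ (w l))) : Fin (e + 1) → CotangentSpace R₁))
    with hM
  obtain ⟨a, ha⟩ := Ideal.mem_span_range_iff_exists_fun.mp hθ
  rw [← ha, delta_sum δ hδadd]
  refine M.sum_mem fun i _ => ?_
  rw [hδmul]
  have hzres : residue R₁ ((Fin.cons x' (fun l => Subring.inclusion hRR₁ (w l)) : Fin (e + 1) → R₁) i) = 0 := by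
    refine Fin.cases ?_ (fun l => ?_) i
    · rw [Fin.cons_zero]
      exact (residue_eq_zero_iff _).mpr hx'm
    · rw [Fin.cons_succ]
      exact hloc (w l) (huw ▸ Ideal.subset_span (Or.inr ⟨l, rfl⟩))
  rw [hzres, zero_smul, add_zero]
  refine M.smul_mem _ (Submodule.subset_span ⟨i, ?_⟩)
  refine Fin.cases ?_ (fun l => ?_) i
  · simp
  · simp

include hloc hperf huw hx'm hx'0 hv hc hδadd hδmul hδmem hδsq hdim₁ hhe hspan hθ hf₁ in
/-- **FIRST ORDER.** If some cleaning `f₁ − g'²` of the transformed radicand lies in `𝔫²`, then the residue vector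
`v̄ = (v̄_j)` is a kernel vector of the polar matrix `B̄_{jk} = Ḡ_{jk} + Ḡ_{kj}`: `Σ_j B̄_{jk} v̄_j = 0` for every `k`.
[folklore] -/
theorem kernel_of_high (hhigh : ∃ g' : R₁, f₁ - g' ^ 2 ∈ maximalIdeal R₁ ^ 2) (k : Fin h) :
    ∑ j, residue R₁ (Subring.inclusion hRR₁ (G j k + G k j)) * residue R₁ (v j) = 0 := by
  classical
  set M := Submodule.span (ResidueField R₁)
      (Set.range (Fin.cons (δ x') (fun l => δ (Subring.inclusion hRR₁ (w l))) : Fin (e + 1) → CotangentSpace R₁))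
    with hM
  set ι := Subring.inclusion hRR₁ with hι
  obtain ⟨g', hg'⟩ := hhigh
  -- `δ f₁ = 0`
  have hδf₁ : δ f₁ = 0 := by
    have h0 : δ (f₁ - g' ^ 2) = 0 := by
      rw [hδmem _ (Ideal.pow_le_self two_ne_zero hg'), Ideal.toCotangent_eq_zero]
      exact hg'
    rwa [delta_sub δ hδadd, hδsq, sub_zero] at h0
  -- `δ` of the double sum, modulo `M`
  set evec : Fin h → ResidueField R₁ := fun k => ∑ j, residue R₁ (ι (G j k + G k j)) * residue R₁ (v j) with hevec
  have hquad : δ (∑ j, ∑ k, ι (G j k) * v j * v k) - ∑ k, evec k • δ (v k) ∈ M := by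
    -- term by term: `δ (G v_j v_k) = Ḡ v̄_j δ v_k + Ḡ v̄_k δ v_j + v̄_j v̄_k δ G`
    have hterm : ∀ j k, δ (ι (G j k) * v j * v k) -
        (residue R₁ (ι (G j k)) * residue R₁ (v j)) • δ (v k) -
        (residue R₁ (ι (G j k)) * residue R₁ (v k)) • δ (v j) ∈ M := by
      intro j k
      have heq : δ (ι (G j k) * v j * v k) -
          (residue R₁ (ι (G j k)) * residue R₁ (v j)) • δ (v k) -
          (residue R₁ (ι (G j k)) * residue R₁ (v k)) • δ (v j) =
          (residue R₁ (v k) * residue R₁ (v j)) • δ (ι (G j k)) := by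
        rw [hδmul, hδmul (ι (G j k)) (v j), map_mul]
        simp only [smul_add, smul_smul]
        rw [mul_comm (residue R₁ (v k)) (residue R₁ (ι (G j k)))]
        abel
      rw [heq]
      exact M.smul_mem _ (delta_inclusion_mem hRR₁ hloc hperf u w huw x' hx'm v hv δ hδadd hδmul hδsq (G j k))
    have hsum : δ (∑ j, ∑ k, ι (G j k) * v j * v k) -
        ∑ j, ∑ k, ((residue R₁ (ι (G j k)) * residue R₁ (v j)) • δ (v k) +
          (residue R₁ (ι (G j k)) * residue R₁ (v k)) • δ (v j)) ∈ M := by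
      rw [delta_sum δ hδadd, ← Finset.sum_sub_distrib]
      refine M.sum_mem fun j _ => ?_
      rw [delta_sum δ hδadd, ← Finset.sum_sub_distrib]
      refine M.sum_mem fun k _ => ?_
      have := hterm j k
      rwa [sub_sub] at this
    have hre : ∑ j, ∑ k, ((residue R₁ (ι (G j k)) * residue R₁ (v j)) • δ (v k) +
          (residue R₁ (ι (G j k)) * residue R₁ (v k)) • δ (v j)) = ∑ k, evec k • δ (v k) := by
      rw [Finset.sum_comm]
      simp only [Finset.sum_add_distrib]
      rw [Finset.sum_comm (f := fun k j => (residue R₁ (ι (G j k)) * residue R₁ (v k)) • δ (v j))]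
      rw [← Finset.sum_add_distrib]
      refine Finset.sum_congr rfl fun k _ => ?_
      rw [← Finset.sum_add_distrib, hevec, Finset.sum_smul]
      refine Finset.sum_congr rfl fun j _ => ?_
      rw [map_add, map_add, add_mul, add_smul]
    rwa [hre] at hsum
  -- hence `Σ evec_k • δ v_k ∈ M`
  have hrel : ∑ k, evec k • δ (v k) ∈ M := by
    have hθM := delta_theta_mem hRR₁ hloc u w huw x' hx'm δ hδadd hδmul θ hθ
    have : δ f₁ = δ (∑ j, ∑ k, ι (G j k) * v j * v k) + δ θ := by
      rw [hf₁, hδadd, hδadd, hδsq, add_zero]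
    rw [hδf₁] at this
    have h4 : δ (∑ j, ∑ k, ι (G j k) * v j * v k) + δ θ = 0 := this.symm
    have h3 : ∑ k, evec k • δ (v k) =
        -(δ (∑ j, ∑ k, ι (G j k) * v j * v k) - ∑ k, evec k • δ (v k)) - δ θ := by
      rw [show -(δ (∑ j, ∑ k, ι (G j k) * v j * v k) - ∑ k, evec k • δ (v k)) - δ θ =
        ∑ k, evec k • δ (v k) - (δ (∑ j, ∑ k, ι (G j k) * v j * v k) + δ θ) by abel, h4, sub_zero]
    rw [h3]
    exact M.sub_mem (M.neg_mem hquad) hθM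
  -- proportional to `c̄`, and the alternating pairing kills the factor
  obtain ⟨t, ht⟩ := smul_of_relation hRR₁ hloc hperf u w huw x' hx'm hx'0 v hv c hc δ hδadd hδmul hδsq
    hdim₁ hhe hspan evec hrel
  haveI : CharP (ResidueField R₁) 2 := by
    have h0 : ((2 : ℕ) : ResidueField R₁) = 0 := by
      have : ((2 : ℕ) : R₁) = 0 := CharP.cast_eq_zero R₁ 2
      rw [← map_natCast (residue R₁), this, map_zero]
    exact (CharP.charP_iff_prime_eq_zero Nat.prime_two).mpr h0
  have hpair : ∑ k, evec k * residue R₁ (v k) = 0 := by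
    simp only [hevec, map_add]
    exact CotangentDerivation.sum_polar_self_eq_zero (fun j k => residue R₁ (ι (G j k))) fun j => residue R₁ (v j)
  have ht0 : t = 0 := by
    have h1 := sum_residue_c_mul_v hRR₁ u x' hx'0 v hv c hc
    have : ∑ k, evec k * residue R₁ (v k) = t * ∑ k, residue R₁ (ι (c k)) * residue R₁ (v k) := by
      rw [Finset.mul_sum]
      exact Finset.sum_congr rfl fun k _ => by rw [ht k, mul_assoc]
    rw [hpair, h1, mul_one] at this
    exact this.symm
  have := ht k
  rw [ht0, zero_mul] at this
  rw [← this]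

end FirstOrder

end Summit.ResolutionOfSingularities.ResolutionOfSingularities.Theorems.SwitchingDichotomy.LowOrderFirst

end
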